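import Summits.Langlands.Langlands.Theses.SkinnerWilesDefectOne

/-!
# Route SkinnerWilesDefectOne — Assembly

The assembly item (stmt-Langlands-12924) of route `SkinnerWilesDefectOne` for the Langlands summit:
`ReducibleOrdinaryProModular → ProModularOrdinaryClassical → SectorComplement → Langlands`.

This is literally the type of the route file's deciding theorem
`Summit.Langlands.Langlands.Theses.SkinnerWilesDefectOne.closes`: the engine
(`ReducibleOrdinaryProModular`, Skinner–Wiles pro-modularity at defect one) and the exit
(`ProModularOrdinaryClassical`, Hida control / classicality) give the sector theorem
`ReducibleOrdinaryModular` — the orientation conjunct and `p`-distinguishedness are dropped from the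
local clause and `FramedGaloisRep.isOrdinaryOfWeightAt_iff_padicAlgCl` repackages the ordinary
frame — and `SectorComplement := ReducibleOrdinaryModular → Langlands` finishes.
-/

set_option linter.dupNamespace false -- project-wide option (lakefile weak.linter.dupNamespace); `Summit.Langlands.Langlands` is the mandated namespace

namespace Summit.Langlands.Langlands.Theorems

/-- **Assembly of route SkinnerWilesDefectOne.**
`ReducibleOrdinaryProModular → ProModularOrdinaryClassical → SectorComplement → Langlands`:
pro-modularity of residually reducible, `p`-distinguished, oriented-ordinary parallel-weight `ρ` over
an imaginary quadratic field, classicality of pro-modular ordinary `ρ`, and the complement of that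
sector imply the summit statement `Langlands` of `Summits/Langlands/Statement.lean`. Proof: unfold
`Assembly` and apply the route's sorry-free deciding theorem `Theses.SkinnerWilesDefectOne.closes`. -/
theorem skinnerWilesDefectOne_assembly_proof :
    Summit.Langlands.Langlands.Theses.SkinnerWilesDefectOne.Assembly := by
  unfold Summit.Langlands.Langlands.Theses.SkinnerWilesDefectOne.Assembly
  exact Summit.Langlands.Langlands.Theses.SkinnerWilesDefectOne.closes

end Summit.Langlands.Langlands.Theorems
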